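import Summits.BirchSwinnertonDyer.BirchSwinnertonDyer.Theses.Squeeze
import Summits.BirchSwinnertonDyer.BirchSwinnertonDyer.Theses.LeadingTerm
import Summits.BirchSwinnertonDyer.BirchSwinnertonDyer.Theses.HigherGrossZagier
import Summits.BirchSwinnertonDyer.BirchSwinnertonDyer.Theorems.LeadingTermSqueezeUBR2ThreeCells
import Literature.NumberTheory.EllipticCurves.TwoDescentLinearConditions
import Literature.NumberTheory.EllipticCurves.LeadingTerm
import Literature.Barriers.BirchSwinnertonDyer.RankNotSumOfLocalInvariantsF4TwistPoints
import HarnessLib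

/-!
# BirchSwinnertonDyer — crux `SqueezeUB` / `SqueezeUBR2` (stmt-BirchSwinnertonDyer-0145),
# line `Sketch`: a kernel-checked inhabitant of the first open cell (rank `≥ 4`)

The three-cell cut of the crux "no excess rank" (`squeezeUB_iff_threeCells`, skeleton v3:
crux ⇔ GZK ∧ PAR ∧ UBE4) leaves open exactly the parity-blind cell UBE4, whose first square is
`(rank, r_an) = (4, 2)`: "an elliptic curve over `ℚ` with four independent rational points has
`ord_{s=1} L(E,s) ≠ 2`". So far that cell was prose or numerics in the tree (kit job j020891:
1 899 curves of `2`-descent rank `4`, all with `L''(E,1) ≈ 0`), which held no elliptic curve of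
certified Mordell–Weil rank `> 2`. This file supplies one:

* `rankFourWitness_four_le_mordellWeilRank`: **`4 ≤ rank_ℤ E₀(ℚ)`** for
  `E₀ : y² = x(x - 46)(x + 246) = x³ + 200x² - 11316x` (`⟨0, 200, 0, -11316, 0⟩`), by the
  complete `2`-descent LOWER bound (Silverman AEC Prop. X.1.4; tree
  `le_mordellWeilRank_of_twoTorsion'` over `linearIndependent_of_twoTorsion` and the Mordell–Weil
  theorem): the images of the integral points `(-243, 459)`, `(-242, 528)`, `(-196, 1540)`,
  `(-138, 1656)` and of the `2`-torsion `(0,0)`, `(46,0)` under `δ = (x, x - 46)` followed by the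
  six quadratic characters `sign δ₁, v₂ δ₁, v₃ δ₁, v₂₃ δ₁, v₄₁ δ₁, v₇₃ δ₂ (mod 2)` are
  `𝔽₂`-independent (curve and points found by a search over `y² = x(x-a)(x+b)`, `a, b ≤ 330`,
  script `work/py/search2.py` in the lead's folder);
* `rankFourWitness_exists`: `∃ W : WeierstrassCurve ℚ, W.IsElliptic ∧ 4 ≤ W.mordellWeilRank`;
* `squeezeUB_four_le_analyticRank_rankFourWitness`: the crux asserts the CHECKABLE
  `4 ≤ ord_{s=1} L(E₀, s)` (the Taylor coefficients of orders `0–3` at `s = 1` vanish, given the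
  continuation); `squeezeUB_not_analyticRank_rankFourWitness_le_three`: a certified
  `ord_{s=1} L(E₀,s) ≤ 3` would refute the crux (and BSD) — the refutable form of the cell on one
  named curve; `threeCells_four_le_analyticRank_rankFourWitness`: the same from the three
  registered cells GZK, PAR, UBE4;
* `two_le_analyticRank_rankFourWitness_of_fact`: Gross–Zagier–Kolyvagin (named fact bsd.S17
  `Literature.NumberTheory.EllipticCurves.rank_eq_analyticRank_of_analyticRank_le_one`, literature
  debt) already gives `2 ≤ ord_{s=1} L(E₀,s)`; the gap from `2` to `4` at `E₀` is precisely UBE4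
  (given parity).

No upper bound `rank ≤ 4`, root number or minimality of `E₀` is claimed or needed. Design: the
curve and the points are LITERALS and the character `ψ` lives inside the one proof that needs it
(no definitions, notations or instances; `IsElliptic E₀` is a theorem used via `haveI`); the
character bookkeeping (`charFst`/`charSnd`, `parityBit_eq_of_eq`, `signBit_of_neg`) is the
tree's, as in `RankNotSumOfLocalInvariantsCNRanksB.lean` (`E265`, rank `2`).

References: Silverman, *The Arithmetic of Elliptic Curves*, 2nd ed. (2009), Prop. X.1.4, Ex. X.1.5
[SilvermanAEC2009]; Cremona, *Algorithms for Modular Elliptic Curves*, 2nd ed. (1997), §3.6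
[CremonaAlgorithms1997]; Darmon, *Rational Points on Modular Elliptic Curves* (2004), Thm. 3.22.
-/

-- D-0017: single-problem summit, so `Summit.BirchSwinnertonDyer.BirchSwinnertonDyer.…` repeats a
-- namespace BY DESIGN.
set_option linter.dupNamespace false

noncomputable section

namespace Summit.BirchSwinnertonDyer.BirchSwinnertonDyer.Theorems

open WeierstrassCurve WeierstrassCurve.Affine WeierstrassCurve.Affine.Point
open Literature.NumberTheory.EllipticCurves Literature.NumberTheory.EllipticCurves.KramerTwoDescent
open Literature.NumberTheory.EllipticCurves.TwoDescentLocal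
open Literature.Barriers.BirchSwinnertonDyer.DokchitserDokchitser2011
open Summit.BirchSwinnertonDyer.BirchSwinnertonDyer.Theses.Squeeze (SqueezeUB)
open Summit.BirchSwinnertonDyer.BirchSwinnertonDyer.Theses.LeadingTerm (SqueezeUBR2)

/-- `Δ(E₀) = 16 · 46² · 246² · 292²` (`= 16 ∏ (eᵢ - eⱼ)²` for the roots `0, 46, -246`).
[folklore] -/
theorem rankFourWitness_Δ :
    (⟨0, 200, 0, -11316, 0⟩ : WeierstrassCurve ℚ).Δ = 16 * 46 ^ 2 * 246 ^ 2 * 292 ^ 2 := by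
  norm_num [WeierstrassCurve.Δ, WeierstrassCurve.b₂, WeierstrassCurve.b₄, WeierstrassCurve.b₆,
    WeierstrassCurve.b₈]

/-- `E₀` is an elliptic curve (`Δ ≠ 0`); a theorem, not an instance. [folklore] -/
theorem rankFourWitness_isElliptic : (⟨0, 200, 0, -11316, 0⟩ : WeierstrassCurve ℚ).IsElliptic :=
  ⟨isUnit_iff_ne_zero.mpr (by rw [rankFourWitness_Δ]; norm_num)⟩

/-- `E₀` has rational `2`-torsion with roots `e₁ = 0, e₂ = 46, e₃ = -246`
(`4x³ + b₂x² + 2b₄x + b₆ = 4x(x - 46)(x + 246)`). [cite: SilvermanAEC2009, Prop. X.1.4] -/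
theorem rankFourWitness_split :
    (⟨0, 200, 0, -11316, 0⟩ : WeierstrassCurve ℚ).toAffine.SplitTwoTorsion 0 46 (-246) := by
  refine ⟨?_, ?_, ?_⟩
  · show WeierstrassCurve.b₂ (⟨0, 200, 0, -11316, 0⟩ : WeierstrassCurve ℚ) = _
    norm_num [WeierstrassCurve.b₂]
  · show WeierstrassCurve.b₄ (⟨0, 200, 0, -11316, 0⟩ : WeierstrassCurve ℚ) = _
    norm_num [WeierstrassCurve.b₄]
  · show WeierstrassCurve.b₆ (⟨0, 200, 0, -11316, 0⟩ : WeierstrassCurve ℚ) = _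
    norm_num [WeierstrassCurve.b₆]

/-- Nonsingular affine points of `E₀` are the solutions of `y² = x³ + 200x² - 11316x`
(`Δ ≠ 0`). [folklore] -/
theorem rankFourWitness_nonsingular_iff (x y : ℚ) :
    (⟨0, 200, 0, -11316, 0⟩ : WeierstrassCurve ℚ).toAffine.Nonsingular x y ↔
      y ^ 2 = x ^ 3 + 200 * x ^ 2 - 11316 * x := by
  rw [← equation_iff_nonsingular_of_Δ_ne_zero (by
    show WeierstrassCurve.Δ (⟨0, 200, 0, -11316, 0⟩ : WeierstrassCurve ℚ) ≠ 0
    rw [rankFourWitness_Δ]; norm_num), WeierstrassCurve.Affine.equation_iff]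
  show y ^ 2 + 0 * x * y + 0 * y = x ^ 3 + 200 * x ^ 2 + (-11316) * x + 0 ↔ _
  constructor <;> intro h <;> linear_combination h

/-- **`4 ≤ rank_ℤ E₀(ℚ)`** for `E₀ : y² = x(x - 46)(x + 246)`: with `δ = (x - 0, x - 46)` the
`2`-descent map (Silverman AEC Prop. X.1.4) and `ψ = (sign δ₁, v₂ δ₁, v₃ δ₁, v₂₃ δ₁, v₄₁ δ₁,
v₇₃ δ₂) mod 2`, the values on `P₁ = (-243, 459)`, `P₂ = (-242, 528)`, `P₃ = (-196, 1540)`,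
`P₄ = (-138, 1656)` (`δ₁ ~ -3, -2, -1, -138`) and on `T₁ = (0,0)`, `T₂ = (46,0)` (`δ₁ ~ -3·23·41`,
`46`; `δ₂(T₂) ~ 2·23·73`) are `𝔽₂`-independent and `ψ T₃ = ψ T₁ + ψ T₂`, so the points are
`ℤ`-independent (tree `le_mordellWeilRank_of_twoTorsion'`). [cite: SilvermanAEC2009, Prop. X.1.4] -/
theorem rankFourWitness_four_le_mordellWeilRank :
    4 ≤ (⟨0, 200, 0, -11316, 0⟩ : WeierstrassCurve ℚ).mordellWeilRank := by
  haveI := rankFourWitness_isElliptic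
  haveI : Fact (Nat.Prime 23) := ⟨by norm_num⟩
  obtain ⟨ψ, hψ⟩ :
      ∃ ψ : (⟨0, 200, 0, -11316, 0⟩ : WeierstrassCurve ℚ).toAffine.Point →+ (Fin 6 → ZMod 2),
        (AddMonoidHom.pi fun i =>
          (![charFst rankFourWitness_split signHom, charFst rankFourWitness_split (parityHom 2),
              charFst rankFourWitness_split (parityHom 3),
              charFst rankFourWitness_split (parityHom 23),
              charFst rankFourWitness_split (parityHom 41),
              charSnd rankFourWitness_split (parityHom 73)] :
            Fin 6 → ((⟨0, 200, 0, -11316, 0⟩ : WeierstrassCurve ℚ).toAffine.Point →+ ZMod 2)) i) =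
          ψ :=
    ⟨_, rfl⟩
  have hψ_some : ∀ (x y : ℚ)
      (hP : (⟨0, 200, 0, -11316, 0⟩ : WeierstrassCurve ℚ).toAffine.Nonsingular x y),
      x ≠ 0 → x ≠ 46 → ψ (.some x y hP) = ![signBit (x - 0), parityBit 2 (x - 0),
        parityBit 3 (x - 0), parityBit 23 (x - 0), parityBit 41 (x - 0),
        parityBit 73 (x - 46)] := by
    intro x y hP hx₁ hx₂
    have hx₁' : x - 0 ≠ 0 := sub_ne_zero.mpr hx₁
    have hx₂' : x - 46 ≠ 0 := sub_ne_zero.mpr hx₂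
    rw [← hψ]
    ext i
    fin_cases i
    · show charFst rankFourWitness_split signHom (.some x y hP) = signBit (x - 0)
      rw [charFst_apply, twoDescentComponent_some_of_ne hP hx₁, signHom_sqClass hx₁']
    · show charFst rankFourWitness_split (parityHom 2) (.some x y hP) = parityBit 2 (x - 0)
      rw [charFst_apply, twoDescentComponent_some_of_ne hP hx₁, parityHom_sqClass hx₁']
    · show charFst rankFourWitness_split (parityHom 3) (.some x y hP) = parityBit 3 (x - 0)
      rw [charFst_apply, twoDescentComponent_some_of_ne hP hx₁, parityHom_sqClass hx₁']
    · show charFst rankFourWitness_split (parityHom 23) (.some x y hP) = parityBit 23 (x - 0)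
      rw [charFst_apply, twoDescentComponent_some_of_ne hP hx₁, parityHom_sqClass hx₁']
    · show charFst rankFourWitness_split (parityHom 41) (.some x y hP) = parityBit 41 (x - 0)
      rw [charFst_apply, twoDescentComponent_some_of_ne hP hx₁, parityHom_sqClass hx₁']
    · show charSnd rankFourWitness_split (parityHom 73) (.some x y hP) = parityBit 73 (x - 46)
      rw [charSnd_apply, twoDescentComponent_some_of_ne hP hx₂, parityHom_sqClass hx₂']
  have hT1 :
      ψ (.some _ _ (nonsingular_twoTorsion rankFourWitness_split)) = ![1, 0, 1, 1, 1, 0] := by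
    have h₁ : (((0 : ℚ) - 46) * ((0 : ℚ) - -246)) ≠ 0 := by norm_num
    have h₂ : ((0 : ℚ) - 46) ≠ 0 := by norm_num
    rw [← hψ]
    ext i
    fin_cases i
    · show charFst rankFourWitness_split signHom _ = 1
      rw [charFst_apply, twoDescentComponent_some_of_eq _ rfl, signHom_sqClass h₁]
      exact signBit_of_neg (by norm_num)
    · show charFst rankFourWitness_split (parityHom 2) _ = 0
      rw [charFst_apply, twoDescentComponent_some_of_eq _ rfl, parityHom_sqClass h₁]
      exact parityBit_eq_of_eq 2 2 (u := 2829) (v := 1) (-1) (Or.inr rfl) (by norm_num)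
        (by norm_num) (by norm_num)
    · show charFst rankFourWitness_split (parityHom 3) _ = 1
      rw [charFst_apply, twoDescentComponent_some_of_eq _ rfl, parityHom_sqClass h₁]
      exact parityBit_eq_of_eq 3 1 (u := 3772) (v := 1) (-1) (Or.inr rfl) (by norm_num)
        (by norm_num) (by norm_num)
    · show charFst rankFourWitness_split (parityHom 23) _ = 1
      rw [charFst_apply, twoDescentComponent_some_of_eq _ rfl, parityHom_sqClass h₁]
      exact parityBit_eq_of_eq 23 1 (u := 492) (v := 1) (-1) (Or.inr rfl) (by norm_num)
        (by norm_num) (by norm_num)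
    · show charFst rankFourWitness_split (parityHom 41) _ = 1
      rw [charFst_apply, twoDescentComponent_some_of_eq _ rfl, parityHom_sqClass h₁]
      exact parityBit_eq_of_eq 41 1 (u := 276) (v := 1) (-1) (Or.inr rfl) (by norm_num)
        (by norm_num) (by norm_num)
    · show charSnd rankFourWitness_split (parityHom 73) _ = 0
      rw [charSnd_apply, twoDescentComponent_some_of_ne _ (by norm_num), parityHom_sqClass h₂]
      exact parityBit_eq_of_eq 73 0 (u := 46) (v := 1) (-1) (Or.inr rfl) (by norm_num)
        (by norm_num) (by norm_num)
  have hT2 : ψ (.some _ _ (nonsingular_twoTorsion rankFourWitness_split.swap₁₂)) =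
      ![0, 1, 0, 1, 0, 1] := by
    have h₁ : ((46 : ℚ) - 0) ≠ 0 := by norm_num
    have h₂ : (((46 : ℚ) - 0) * ((46 : ℚ) - -246)) ≠ 0 := by norm_num
    rw [← hψ]
    ext i
    fin_cases i
    · show charFst rankFourWitness_split signHom _ = 0
      rw [charFst_apply, twoDescentComponent_some_of_ne _ (by norm_num), signHom_sqClass h₁]
      exact signBit_of_nonneg (by norm_num)
    · show charFst rankFourWitness_split (parityHom 2) _ = 1
      rw [charFst_apply, twoDescentComponent_some_of_ne _ (by norm_num), parityHom_sqClass h₁]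
      exact parityBit_eq_of_eq 2 1 (u := 23) (v := 1) (1) (Or.inl rfl) (by norm_num)
        (by norm_num) (by norm_num)
    · show charFst rankFourWitness_split (parityHom 3) _ = 0
      rw [charFst_apply, twoDescentComponent_some_of_ne _ (by norm_num), parityHom_sqClass h₁]
      exact parityBit_eq_of_eq 3 0 (u := 46) (v := 1) (1) (Or.inl rfl) (by norm_num)
        (by norm_num) (by norm_num)
    · show charFst rankFourWitness_split (parityHom 23) _ = 1
      rw [charFst_apply, twoDescentComponent_some_of_ne _ (by norm_num), parityHom_sqClass h₁]
      exact parityBit_eq_of_eq 23 1 (u := 2) (v := 1) (1) (Or.inl rfl) (by norm_num)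
        (by norm_num) (by norm_num)
    · show charFst rankFourWitness_split (parityHom 41) _ = 0
      rw [charFst_apply, twoDescentComponent_some_of_ne _ (by norm_num), parityHom_sqClass h₁]
      exact parityBit_eq_of_eq 41 0 (u := 46) (v := 1) (1) (Or.inl rfl) (by norm_num)
        (by norm_num) (by norm_num)
    · show charSnd rankFourWitness_split (parityHom 73) _ = 1
      rw [charSnd_apply, twoDescentComponent_some_of_eq _ rfl, parityHom_sqClass h₂]
      exact parityBit_eq_of_eq 73 1 (u := 184) (v := 1) (1) (Or.inl rfl) (by norm_num)
        (by norm_num) (by norm_num)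
  have hT3 : ψ (.some _ _ (nonsingular_twoTorsion rankFourWitness_split.swap₂₃.swap₁₂)) =
      ![1, 1, 1, 0, 1, 1] := by
    have h₁ : ((-246 : ℚ) - 0) ≠ 0 := by norm_num
    have h₂ : ((-246 : ℚ) - 46) ≠ 0 := by norm_num
    rw [← hψ]
    ext i
    fin_cases i
    · show charFst rankFourWitness_split signHom _ = 1
      rw [charFst_apply, twoDescentComponent_some_of_ne _ (by norm_num), signHom_sqClass h₁]
      exact signBit_of_neg (by norm_num)
    · show charFst rankFourWitness_split (parityHom 2) _ = 1
      rw [charFst_apply, twoDescentComponent_some_of_ne _ (by norm_num), parityHom_sqClass h₁]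
      exact parityBit_eq_of_eq 2 1 (u := 123) (v := 1) (-1) (Or.inr rfl) (by norm_num)
        (by norm_num) (by norm_num)
    · show charFst rankFourWitness_split (parityHom 3) _ = 1
      rw [charFst_apply, twoDescentComponent_some_of_ne _ (by norm_num), parityHom_sqClass h₁]
      exact parityBit_eq_of_eq 3 1 (u := 82) (v := 1) (-1) (Or.inr rfl) (by norm_num)
        (by norm_num) (by norm_num)
    · show charFst rankFourWitness_split (parityHom 23) _ = 0
      rw [charFst_apply, twoDescentComponent_some_of_ne _ (by norm_num), parityHom_sqClass h₁]
      exact parityBit_eq_of_eq 23 0 (u := 246) (v := 1) (-1) (Or.inr rfl) (by norm_num)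
        (by norm_num) (by norm_num)
    · show charFst rankFourWitness_split (parityHom 41) _ = 1
      rw [charFst_apply, twoDescentComponent_some_of_ne _ (by norm_num), parityHom_sqClass h₁]
      exact parityBit_eq_of_eq 41 1 (u := 6) (v := 1) (-1) (Or.inr rfl) (by norm_num)
        (by norm_num) (by norm_num)
    · show charSnd rankFourWitness_split (parityHom 73) _ = 1
      rw [charSnd_apply, twoDescentComponent_some_of_ne _ (by norm_num), parityHom_sqClass h₂]
      exact parityBit_eq_of_eq 73 1 (u := 4) (v := 1) (-1) (Or.inr rfl) (by norm_num)
        (by norm_num) (by norm_num)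
  have hP1 : ∀ hP : (⟨0, 200, 0, -11316, 0⟩ : WeierstrassCurve ℚ).toAffine.Nonsingular (-243) 459,
      ψ (.some (-243) 459 hP) = ![1, 0, 1, 0, 0, 0] := by
    intro hP
    rw [hψ_some _ _ _ (by norm_num) (by norm_num)]
    ext i
    fin_cases i
    · show signBit _ = 1
      exact signBit_of_neg (by norm_num)
    · show parityBit 2 _ = 0
      exact parityBit_eq_of_eq 2 0 (u := 243) (v := 1) (-1) (Or.inr rfl) (by norm_num)
        (by norm_num) (by norm_num)
    · show parityBit 3 _ = 1
      exact parityBit_eq_of_eq 3 5 (u := 1) (v := 1) (-1) (Or.inr rfl) (by norm_num)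
        (by norm_num) (by norm_num)
    · show parityBit 23 _ = 0
      exact parityBit_eq_of_eq 23 0 (u := 243) (v := 1) (-1) (Or.inr rfl) (by norm_num)
        (by norm_num) (by norm_num)
    · show parityBit 41 _ = 0
      exact parityBit_eq_of_eq 41 0 (u := 243) (v := 1) (-1) (Or.inr rfl) (by norm_num)
        (by norm_num) (by norm_num)
    · show parityBit 73 _ = 0
      exact parityBit_eq_of_eq 73 0 (u := 289) (v := 1) (-1) (Or.inr rfl) (by norm_num)
        (by norm_num) (by norm_num)
  have hP2 : ∀ hP : (⟨0, 200, 0, -11316, 0⟩ : WeierstrassCurve ℚ).toAffine.Nonsingular (-242) 528,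
      ψ (.some (-242) 528 hP) = ![1, 1, 0, 0, 0, 0] := by
    intro hP
    rw [hψ_some _ _ _ (by norm_num) (by norm_num)]
    ext i
    fin_cases i
    · show signBit _ = 1
      exact signBit_of_neg (by norm_num)
    · show parityBit 2 _ = 1
      exact parityBit_eq_of_eq 2 1 (u := 121) (v := 1) (-1) (Or.inr rfl) (by norm_num)
        (by norm_num) (by norm_num)
    · show parityBit 3 _ = 0
      exact parityBit_eq_of_eq 3 0 (u := 242) (v := 1) (-1) (Or.inr rfl) (by norm_num)
        (by norm_num) (by norm_num)
    · show parityBit 23 _ = 0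
      exact parityBit_eq_of_eq 23 0 (u := 242) (v := 1) (-1) (Or.inr rfl) (by norm_num)
        (by norm_num) (by norm_num)
    · show parityBit 41 _ = 0
      exact parityBit_eq_of_eq 41 0 (u := 242) (v := 1) (-1) (Or.inr rfl) (by norm_num)
        (by norm_num) (by norm_num)
    · show parityBit 73 _ = 0
      exact parityBit_eq_of_eq 73 0 (u := 288) (v := 1) (-1) (Or.inr rfl) (by norm_num)
        (by norm_num) (by norm_num)
  have hP3 : ∀ hP : (⟨0, 200, 0, -11316, 0⟩ : WeierstrassCurve ℚ).toAffine.Nonsingular (-196) 1540,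
      ψ (.some (-196) 1540 hP) = ![1, 0, 0, 0, 0, 0] := by
    intro hP
    rw [hψ_some _ _ _ (by norm_num) (by norm_num)]
    ext i
    fin_cases i
    · show signBit _ = 1
      exact signBit_of_neg (by norm_num)
    · show parityBit 2 _ = 0
      exact parityBit_eq_of_eq 2 2 (u := 49) (v := 1) (-1) (Or.inr rfl) (by norm_num)
        (by norm_num) (by norm_num)
    · show parityBit 3 _ = 0
      exact parityBit_eq_of_eq 3 0 (u := 196) (v := 1) (-1) (Or.inr rfl) (by norm_num)
        (by norm_num) (by norm_num)
    · show parityBit 23 _ = 0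
      exact parityBit_eq_of_eq 23 0 (u := 196) (v := 1) (-1) (Or.inr rfl) (by norm_num)
        (by norm_num) (by norm_num)
    · show parityBit 41 _ = 0
      exact parityBit_eq_of_eq 41 0 (u := 196) (v := 1) (-1) (Or.inr rfl) (by norm_num)
        (by norm_num) (by norm_num)
    · show parityBit 73 _ = 0
      exact parityBit_eq_of_eq 73 0 (u := 242) (v := 1) (-1) (Or.inr rfl) (by norm_num)
        (by norm_num) (by norm_num)
  have hP4 : ∀ hP : (⟨0, 200, 0, -11316, 0⟩ : WeierstrassCurve ℚ).toAffine.Nonsingular (-138) 1656,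
      ψ (.some (-138) 1656 hP) = ![1, 1, 1, 1, 0, 0] := by
    intro hP
    rw [hψ_some _ _ _ (by norm_num) (by norm_num)]
    ext i
    fin_cases i
    · show signBit _ = 1
      exact signBit_of_neg (by norm_num)
    · show parityBit 2 _ = 1
      exact parityBit_eq_of_eq 2 1 (u := 69) (v := 1) (-1) (Or.inr rfl) (by norm_num)
        (by norm_num) (by norm_num)
    · show parityBit 3 _ = 1
      exact parityBit_eq_of_eq 3 1 (u := 46) (v := 1) (-1) (Or.inr rfl) (by norm_num)
        (by norm_num) (by norm_num)
    · show parityBit 23 _ = 1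
      exact parityBit_eq_of_eq 23 1 (u := 6) (v := 1) (-1) (Or.inr rfl) (by norm_num)
        (by norm_num) (by norm_num)
    · show parityBit 41 _ = 0
      exact parityBit_eq_of_eq 41 0 (u := 138) (v := 1) (-1) (Or.inr rfl) (by norm_num)
        (by norm_num) (by norm_num)
    · show parityBit 73 _ = 0
      exact parityBit_eq_of_eq 73 0 (u := 184) (v := 1) (-1) (Or.inr rfl) (by norm_num)
        (by norm_num) (by norm_num)
  refine le_mordellWeilRank_of_twoTorsion' rankFourWitness_split ψ
    ![.some (-243) 459 ((rankFourWitness_nonsingular_iff _ _).mpr (by norm_num)),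
      .some (-242) 528 ((rankFourWitness_nonsingular_iff _ _).mpr (by norm_num)),
      .some (-196) 1540 ((rankFourWitness_nonsingular_iff _ _).mpr (by norm_num)),
      .some (-138) 1656 ((rankFourWitness_nonsingular_iff _ _).mpr (by norm_num))] ?_ ?_
  · rw [hT1, hT2, hT3]; decide
  · intro c ε₁ ε₂ hc
    simp only [Fin.sum_univ_succ, Fin.sum_univ_zero, Matrix.cons_val_zero, Matrix.cons_val_succ,
      hP1, hP2, hP3, hP4, hT1, hT2] at hc
    revert hc ε₁ ε₂ c
    decide

/-- **The first open cell is inhabited on the arithmetic side, in the tree**: there is an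
elliptic curve over `ℚ` with at least four independent rational points. [folklore] -/
theorem rankFourWitness_exists : ∃ W : WeierstrassCurve ℚ, W.IsElliptic ∧ 4 ≤ W.mordellWeilRank :=
  ⟨_, rankFourWitness_isElliptic, rankFourWitness_four_le_mordellWeilRank⟩

/-- **What the crux asserts at `E₀`** (checkable in print, refutable in principle):
`SqueezeUB ⇒ 4 ≤ ord_{s=1} L(E₀, s)`, i.e. the Taylor coefficients of `L(E₀, s)` at `s = 1` of
orders `0, 1, 2, 3` vanish (given the entire continuation). [folklore] -/
theorem squeezeUB_four_le_analyticRank_rankFourWitness (h : SqueezeUB) :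
    4 ≤ (⟨0, 200, 0, -11316, 0⟩ : WeierstrassCurve ℚ).analyticRank :=
  rankFourWitness_four_le_mordellWeilRank.trans (@h _ rankFourWitness_isElliptic)

/-- The same under the route-LeadingTerm name of the crux. [folklore] -/
theorem squeezeUBR2_four_le_analyticRank_rankFourWitness (h : SqueezeUBR2) :
    4 ≤ (⟨0, 200, 0, -11316, 0⟩ : WeierstrassCurve ℚ).analyticRank :=
  squeezeUB_four_le_analyticRank_rankFourWitness h

/-- **Kill switch of the crux at `E₀`**: under `SqueezeUB` the analytic rank of `E₀` cannot be
certified `≤ 3` — contrapositively, a certified `ord_{s=1} L(E₀, s) ≤ 3` (e.g. a non-zero second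
Taylor coefficient with `L(E₀,1) = 0`) would refute the crux and BSD: the refutable form of the
first open cell on one named curve (no such certificate exists; numerically every known rank-`4`
curve has vanishing second coefficient). [folklore] -/
theorem squeezeUB_not_analyticRank_rankFourWitness_le_three (h : SqueezeUB) :
    ¬ (⟨0, 200, 0, -11316, 0⟩ : WeierstrassCurve ℚ).analyticRank ≤ 3 := fun h3 => by
  have h4 := squeezeUB_four_le_analyticRank_rankFourWitness h
  omega

/-- **The three cells of skeleton v3 at `E₀`**: GZK (`r_an ≤ 1 → rank ≤ r_an`), PAR (odd excess
excluded) and UBE4 (even excess above four points excluded), stated on globally minimal models as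
registered, together give `4 ≤ ord_{s=1} L(E₀,s)` (through `squeezeUB_iff_threeCells`, which
transports to a global minimal model). [folklore] -/
theorem threeCells_four_le_analyticRank_rankFourWitness
    (hGZK : ∀ (W : WeierstrassCurve ℚ) [W.IsElliptic] [W.IsGloballyMinimal],
      W.analyticRank ≤ 1 → W.mordellWeilRank ≤ W.analyticRank)
    (hPAR : ∀ (W : WeierstrassCurve ℚ) [W.IsElliptic] [W.IsGloballyMinimal],
      2 ≤ W.analyticRank → W.mordellWeilRank % 2 ≠ W.analyticRank % 2 →
        W.mordellWeilRank ≤ W.analyticRank)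
    (hUBE4 : ∀ (W : WeierstrassCurve ℚ) [W.IsElliptic] [W.IsGloballyMinimal],
      4 ≤ W.mordellWeilRank → 2 ≤ W.analyticRank → W.mordellWeilRank % 2 = W.analyticRank % 2 →
        W.mordellWeilRank ≤ W.analyticRank) :
    4 ≤ (⟨0, 200, 0, -11316, 0⟩ : WeierstrassCurve ℚ).analyticRank :=
  squeezeUB_four_le_analyticRank_rankFourWitness
    (squeezeUB_iff_threeCells.mpr ⟨hGZK, hPAR, hUBE4⟩)

/-- **Already a theorem in print at `E₀`**: Gross–Zagier–Kolyvagin (named fact bsd.S17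
`rank_eq_analyticRank_of_analyticRank_le_one`, `ord_{s=1} L(E,s) ≤ 1 ⇒ rank = ord`; literature
debt) forces `2 ≤ ord_{s=1} L(E₀,s)`; the step from `2` to `4` is exactly the open cell UBE4
(given parity). CONDITIONAL on the named fact. [cite: Darmon2004, Thm. 3.22] -/
theorem two_le_analyticRank_rankFourWitness_of_fact
    (hS17 : Literature.NumberTheory.EllipticCurves.rank_eq_analyticRank_of_analyticRank_le_one) :
    2 ≤ (⟨0, 200, 0, -11316, 0⟩ : WeierstrassCurve ℚ).analyticRank := by
  by_contra hlt
  have h1 : (⟨0, 200, 0, -11316, 0⟩ : WeierstrassCurve ℚ).analyticRank ≤ 1 := by omega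
  have h := (@hS17 _ rankFourWitness_isElliptic h1).1
  have h4 := rankFourWitness_four_le_mordellWeilRank
  omega

end Summit.BirchSwinnertonDyer.BirchSwinnertonDyer.Theorems

end
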